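import Mathlib
import HarnessLib
import HarnessLib.Audit
import Summits.PneNP.Statement
import Literature.Computability.Complexity.Classes
import Literature.Computability.Complexity.Nondeterministic
import Literature.Computability.Complexity.CircuitClasses
import Literature.Computability.Complexity.CNF
import Literature.Computability.MetaComplexity.MCSP
import Literature.Computability.MetaComplexity.Magnification
import Literature.Computability.Complexity.ClayProblemProofs
import Literature.Computability.Complexity.CircuitClassesUniformProofs
import Summits.PneNP.PneNP.Theorems.CircuitAssemblyStandalone
import HarnessLib.Audit.Status.Attr

/-!
Route: Circuit

DORMANT since 2026-08-23T13:43:45Z (reconciler: no traction for 6.1 d (last activity item-evidence-added at 2026-08-17T11:11:45Z); parked, not closed — `ledger route dormant route-PneNP-Circuit --off` to reactivate) — unstaffed, not closed; items shared with open routes are served there. `ledger route dormant <id> --off` reactivates.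

# Route PneNP/Circuit — "NP ⊄ P/poly, attacked through MCSP: turn the natural-proofs barrier into
the target"

## Thesis X (it suffices to show)
Words: some language in NP is decided by no polynomial-size family of Boolean circuits (Cook, Clay
problem description §3; pnp.S02; AroraBarakCC2009 §6.4).
Lean: `¬ (Literature.Computability.Complexity.Nondeterministic.NP ⊆
Literature.Computability.Complexity.PPoly)`   (= item `CircuitThesis`; rfl-equal to the registered
OPEN statement `Literature.Computability.Complexity.NPNotSubsetPPoly`, which the route deliberately
does not reference so that no open named fact sits in its dependency cone)

## Deciding theorem X → PneNP (rev 2)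
`closes : CircuitThesis → _root_.PneNP`, proved inside the route file by pure logic from three
DISCHARGED Literature facts — the model bridges
`Literature.Computability.Complexity.P_bool_eq_holds` (Cook's P over {0,1} = prelude `Classes.P`)
and `Literature.Computability.Complexity.NP_bool_eq_holds` (Cook's checking-relation NP =
certificate NP, `ClayProblemProofs`), and `Literature.Computability.Complexity.P_subset_PPoly_holds`
(P ⊆ P/poly, AroraBarakCC2009 Thm 6.6, `CircuitClassesUniformProofs`): if every Cook-NP language
were in Cook-P then NP ⊆ P ⊆ P/poly, contradicting X. The `Assembly` item is restated as
`CircuitThesis → PneNP` (rev 1 carried those facts as unlisted hypotheses) and is closable by `fun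
hX => closes hX`; crux #2 reaches X through the support item `CircuitMcspGlue`.

Rationale: WHY THIS LINE. (combinatorics of Boolean functions; meta-mathematics of lower bounds) The
non-uniform strengthening X = NP ⊄ P/poly is where all unconditional lower-bound technique lives
(Håstad, Razborov, Williams [WilliamsSTOC2010, Williams2014 =
`Literature.Computability.Complexity.williams_acc`]) and where the obstruction is itself a theorem:
natural proofs [RazborovRudich1997] = `Literature.Computability.Complexity.natural_proofs_barrier`.
The organising idea is Razborov–Rudich duality read forwards: "MCSP ∈ P/poly" IS a P/poly-natural
property useful against P/poly, so crux #2 (MCSP ∉ P/poly) is at once an instance of X (MCSP ∈ NP,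
`Literature.Computability.MetaComplexity.MCSP_mem_NP`) and the statement that the barrier's
hypothesis (hard PRGs) is consistent with proving X [KabanetsCai2000]. Hardness magnification
[MckayMurrayWilliams2019; arXiv:1911.08297] is the second lever: barely-superlinear lower bounds for
MCSP[s] in weak models already imply X, and the locality barrier of the same paper says which known
techniques cannot cross that threshold. No other area is imported: this is the BASELINE non-uniform
route against which the widened PneNP routes are measured.
RANKED CRUXES. #2 CircuitMcspNotPpoly — MCSP ∉ P/poly (why it might fail: only conditional evidence,
⇐ 2^{n^ε}-hard one-way functions via RazborovRudich1997 Thm 4.1 + KabanetsCai2000; not implied by X,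
since NP-hardness of MCSP under poly-time reductions already gives EXP ≠ ZPP, MurrayWilliams2017 Thm
1.6). #3 CircuitSatQuadraticSize — SAT ∉ SIZE(c·n²+c) for every c (why: no superlinear size bound is
known for any NP function, frontier 3.1n − o(n) [LiYang2022 Thm 1.1]; gate elimination provably
stalls at O(n) [GolovnevHirschKnopKulikov2016]). #4 CircuitNexpNotPpoly — NEXP ⊄ P/poly, a NECESSARY
milestone (why: NEXP ⊆ P/poly holds relative to an algebrizing oracle [AaronsonWigderson2008 Thm
5.6], so non-algebrizing ideas are needed; the algorithmic method reaches ACC⁰∘THR only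
[Williams2014]; ¬#4 is equivalent to NEXP = MA [ImpagliazzoKabanetsWigderson2002]). #5
CircuitMagnificationFrontierR (stmt-PneNP-13658) — for some time-constructible s with log s(n) =
o(n), MCSP[s] = `MCSPSize s` ∉ SIZE(N·s(⌊log₂N⌋)^c + c) for every c: the CIRCUIT form of hardness
magnification [MckayMurrayWilliams2019 Thm 1.4, third bullet, p.3: for s(n) ≥ n and A ∈ PH, if
search-MCSP^A[s(n)] has no circuits of N·poly(s(n)) size and poly(s(n)) depth then NP ⊄ P/poly; the
item is the A = ∅, decision, depth-free, B₂ strengthening of that hypothesis, so it still magnifies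
to X] (why it might fail: it is a superlinear — N·ω(polylog N) — B₂-size lower bound for an explicit
NP language, record 3.1N − o(N) [LiYang2022 Thm 1.1], and it must be NON-LOCALIZABLE, since MCSP[s]
has O(N)-size circuits with Σ₃SAT-oracle gates of fan-in Õ(s³) [MckayMurrayWilliams2019 Thm 1.1 /
Lemma 3.1; arXiv191108297 Thm 2 = `Literature.Barriers.PneNP.Locality`]). Docking: its magnification
fact is VENDORED — `Literature.Computability.MetaComplexity.MckayMurrayWilliams2019_thm14`
(CircuitMagnification.lean, p63715 / wi-25913: ∀ s, (∀ n, n ≤ s n) → (∀ c, MCSPSize s ∉ SIZE(N ↦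
N·s(⌊log₂N⌋)^c + c)) → ¬(NP ⊆ PPoly); consumer `not_NP_subset_PPoly_of_MCSP_lowerBound`) — kept OUT
of every signature (unproved); the FACT-FREE glue `#5R → CircuitThesis` is the support item
CircuitMagnificationGlue (g3, 2026-08-15: `rfl`-equal to `CircuitMagnificationFrontierR →
CircuitThesis`; `fact → glue` in two lines via `IsTimeConstructible.1`; `closes (glue h5R) : PneNP`;
Sketch.lean rc 0). Its predecessor CircuitMagnificationFrontier (stmt-PneNP-0265, the one-pass
STREAMING form of MMW19 Thm 1.3) was REFUTED on 2026-08-15 by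
`Summit.PneNP.PneNP.Theorems.Circuit2CircuitMagnificationFrontier_refuted` @ 4bec25c2c3a7: in the
tree's STREAM model (per-N one-step TM2 update machines make update time vacuous; update maps are
arbitrary) MCSP[s] ∈ STREAM(s^60+60, same) for EVERY s ≥ n, so the streaming hypothesis holds for NO
s — dead in substance over that model (the refuter's label 'misstated' refers to MMW's uniform RAM
model, which the tree cannot express yet); it is dropped from the active items, kept in the
negatives index (`ledger negatives --problem PneNP`), never reworded or re-filed. ROUTE CHOICE
2026-08-15 (unit rchoice-PneNP-Circuit-stmt-PneNP-0265): NEXT LINE = #5R — a different class (SIZE,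
not STREAM) and a different theorem (Thm 1.4, not 1.3), untouched by the witness (which builds no
circuit), grounded (g25-39) and crux-attacked (rattack-13658: survives) — not retirement: `closes`
needs only CircuitThesis and #2–#4 are untouched; CONFIRMED by the g3 pass of the same unit (witness
re-read: a STREAM membership for every s ≥ n, no SIZE content; negatives index: 5 PneNP entries,
none near #5R; #5R checked g44-39, grounded open-problem g25-39, crux-attack survives), which wired
#5R to X inside the route instead of filing any new crux. Support: CircuitMcspGlue (#2 → X, two
lines from `MCSP_mem_NP_holds`); CircuitMagnificationGlue (#5R → X: MMW19 Thm 1.4 third bullet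
specialised to the crux — a published theorem, closable by formalising MMW19 Lemma 3.1 + §5 over
`MCSPSize`/`SIZE`, or in two lines once `MckayMurrayWilliams2019_thm14` is discharged). Target:
CircuitThesis = X; deciding theorem `closes : CircuitThesis → PneNP` proved (rev 2, re-certified at
the repair).
KILL CRITERIA. NP ⊆ P/poly (¬X; its only proved cost is PH = Σ₂ᵖ via
`Literature.Computability.Complexity.karp_lipton`) closes the route (refuted:CircuitThesis), not the
problem. NEXP ⊆ P/poly (¬#4) closes the route, since X ⇒ #4. MCSP ∈ P/poly (¬#2) does not close the
route but removes its organising idea: pivot to #3/#5 with SAT or Clique. #5R is not load-bearing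
for `closes` (which needs only CircuitThesis): ¬#5R — an N·s^c-size B₂ family deciding MCSP[s] at
every length, for EVERY admissible s — would retire the magnification lever at this frontier, not
the route (continue with #2–#4); the rev-2 clause '#5 refuted as signed by the streaming-model
artefact ⇒ move to the circuit form' was EXERCISED on 2026-08-15 (0265 refuted; #5R = exactly the
circuit form named here at rev 2). If #5R itself is refuted (or a Literature theorem shows every
N·s^{ω(1)} B₂ bound for MCSP[2^{o(n)}] must localise), magnification is retired from this route for
good: no third magnification statement is filed (the uniform-streaming form of Thm 1.3 stays unfiled
absent an honest uniform update-time model in Literature), and the route stands or falls with #2–#4.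
¬CircuitMagnificationGlue would contradict MMW19 Thm 1.4 in print: a tree refutation of the glue can
only be a model artefact of `MCSPSize`/`SIZE`/`PPoly` (misstated ⇒ repair the Literature
definitions, not the line).
NOT DECOMPOSED YET. Which restricted model to push first (De Morgan formulas at N^{3+ε} for
MCSP[2^{√n}] against the known N^{3−o(1)} shrinkage bounds [ChenJinWilliams2020 Thm 1.5/1.6],
ACC⁰∘THR, depth-3 AC⁰ at 2^{ω(√n)}); the magnification fact for #5R is VENDORED —
`MckayMurrayWilliams2019_thm14`, the decision/B₂ corollary of MMW19 Thm 1.4 third bullet (p.3; proof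
§5 p.16: Lemma 3.1 with ℓ = s³ gives an O(N)-size oracle circuit whose Circuit-Min-Merge gates of
fan-in Õ(s³) become poly(s)-size circuits under NP ⊆ P/poly) — but it is an UNPROVED named fact
(D-0026 debt +1), so the fact itself is named in no item (it would put an open constant into the
route's cone — today 0 unproved deps, staffable — and a Theorems proof under `(h : fact)` credits
nothing, audit class proof.conditional); filed instead (g3) is the fact-free glue
CircuitMagnificationGlue = `#5R → CircuitThesis` over MCSPSize/SIZE/NP/PPoly only (cone unchanged),
whose proof is the formalisation of MMW19 Lemma 3.1 + §5 (a formalisation task, not an open problem;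
the same work discharges the Literature fact); no split of #5R until it shows census progress; the
UNIFORM streaming form of MMW19 Thm 1.3 (one machine for all N, poly(s) space AND update time in the
RAM model, pp.5–7) would need a new Literature definition replacing
`StreamingAlgorithm.HasUpdateTime`'s ∀N ∃M and is deliberately not filed now; GCT is NOT used here
(the Bürgisser bridge runs NP ⊄ P/poly → VP ≠ VNP [Burgisser2000], the wrong direction for PneNP).
CHEAPEST FALSIFIER. For the line itself none is cheap (¬X is open; refuting X would collapse PH to
Σ₂ᵖ). The rev-2 falsifier for #5 — typecheck the poly(s)-space one-pass streaming algorithm for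
MCSP[s] [MckayMurrayWilliams2019 p.3 'no information-theoretic barrier'] as a member of `STREAM (N ↦
s(log₂N)^c+c) (same)` — was RUN and SUCCEEDED (refuter-rreview1, p61899:
`Circuit2CircuitMagnificationFrontier_refuted`), hence the repair. For #5R (stmt-PneNP-13658) the
small end is vacuous by design (c = 0: no size-0 B₂-circuit on Fin 0, so SIZE(N·s^0+0) = ∅; the
content is c → ∞, an N·s(n)^{ω(1)} bound at infinitely many lengths N = 2ⁿ), so the one cheap check
left is a CONSTRUCTION: an N·s(n)^c-size B₂ family deciding MCSP[s] at all lengths for every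
admissible s. None is known — brute force costs 2^{O(s log s)}·N, and the YES-set has ≥ 2^{s/8}
tables per length N = 2ⁿ once 8 ≤ s ≤ 4·2ⁿ (all functions of the first k variables, 2^k ≤ s/4 <
2^{k+1}, each of B₂-size < 4·2^k ≤ s by Shannon expansion), so no sparse-set / hashing shortcut; by
MMW19 Thm 1.4 such a family exists IF NP ⊆ P/poly, so ¬#5R is implied by ¬X but not conversely. The
honest expectation is that #5R is open, like #2–#4. CircuitMagnificationGlue has none (published
theorem); its cheap checks (`rfl` unfolding to `#5R → X`, two-line docking from the vendored fact)
were run, g3 Sketch.lean rc 0.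
SOURCES. CookClay2006; KarpLipton1980; RazborovRudich1997; KabanetsCai2000; WilliamsSTOC2010;
Williams2014; MckayMurrayWilliams2019; arXiv191108297; ChenJinWilliams2020; MurrayWilliams2017;
GolovnevHirschKnopKulikov2016; LiYang2022; AaronsonWigderson2008; ImpagliazzoKabanetsWigderson2002;
Burgisser2000; AroraBarakCC2009.

Novelty: NOVELTY (search-before-claim, 2026-08-14: `lit search --hybrid` / `--source local` on "hardness
magnification MCSP streaming", "MCSP P/poly natural proofs", "limits of gate elimination", "easy
witness NEXP", "algebrization NEXP P/poly"; `lit frontier PneNP --since 2020`; `lit bridges PneNP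
--cross any`; `lit read` of MckayMurrayWilliams2019 pp.2-5,14, arXiv191108297, ChenJinWilliams2020
pp.3-4, AaronsonWigderson2008 pp.26-27, MurrayWilliams2017 p.14, GolovnevHirschKnopKulikov2016 p.3).
Nearest prior art FOUND: the route's two levers ARE the published programme. (i) Natural-proofs
duality for MCSP: RazborovRudich1997 Thm 4.1 with KabanetsCai2000 (MCSP ∈ P/poly ⇒ no 2^{n^ε}-hard
PRG), AroraBarakCC2009 Thm 23.1, the non-NP-hardness obstructions of MurrayWilliams2017 (Thm 1.3,
1.6, 4.1), surveyed in Allender's "The new complexity landscape around circuit minimization"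
(doi:10.1007/978-3-030-40608-0_1). (ii) Hardness magnification for MCSP[s]: MckayMurrayWilliams2019
(Thm 1.3 streaming ⇒ P ≠ NP; Thm 1.4 circuits ⇒ NP ⊄ P/poly), Oliveira–Pich–Santhanam CCC 2019
(doi:10.4230/LIPIcs.CCC.2019.27), ChenJinWilliams2020 (sharp thresholds, p.3 "widely believed that
MCSP[s(n)] … not in P/poly"), and the locality analysis arXiv191108297 (CHOPRS, "Beyond natural
proofs").
Delta: NONE in mechanism — by its own rationale this is the BASELINE non-uniform route (NP ⊄ P/poly
organised around MCSP) against which widened routes are measured; expected novelty grade: known.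
What it adds is formal onl  [refs: 10.1007/978-3-030-40608-0_1, 10.4230/LIPIcs.CCC.2019.27, doi:10.1007/978-3-030-40608-0_1, doi:10.4230/LIPIcs.CCC.2019.27, MckayMurrayWilliams2019, ChenJinWilliams2020, AaronsonWigderson2008, MurrayWilliams2017, GolovnevHirschKnopKulikov2016, RazborovRudich1997, KabanetsCai2000, AroraBarakCC2009]

Barriers (technique_class: hardness-magnification, natural-proofs, mcsp, b2-circuits): technique_class: hardness-magnification, natural-proofs, mcsp, b2-circuits
- Literature.Barriers.PneNP.NaturalProofs (=
Literature.Computability.Complexity.natural_proofs_barrier; NaturalProofs.no_naturalProof_for,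
RazborovRudich1997 Thm 4.1): APPLIES in full to the target X = NPNotSubsetPPoly, to crux #2 (MCSP ∉
P/poly) and to #4 (NEXP ⊄ P/poly) — every P/poly-natural property useful against P/poly is excluded
conditionally on HardPRGExist. NOT evaded: the route's stance is to make the barrier's pivot the
target (#2 says precisely that the P/poly-constructive useful property "MCSP ∈ P/poly" does not
exist) and to aim technique at magnification regimes (#5R) whose required weak lower bounds lie
below the largeness/usefulness the barrier needs [arXiv191108297 §1.2]. For #3 (n² for SAT) it bites
only under near-linear-size exponentially secure PRFs, i.e. weakly.
- Literature.Barriers.PneNP.NaturalProofsTC0 (NaorReingold2004): APPLIES a fortiori — X ⇒ NP ⊄ TC⁰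
and candidate PRFs live in TC⁰ (GDH/factoring), so whatever property a proof of X, #2 or #4 uses
must already be non-natural at TC⁰. Not evaded; same stance as above.
- Literature.Barriers.PneNP.Locality (Locality.not_localizing_clique_lower_bound; arXiv191108297 Thm
2 / Prop 50): APPLIES to the magnification lever (#5R and any formula re-targeting): catalogued for
HM Frontier E, in print for A–D; for the circuit form #5R the localising UPPER bound is
MckayMurrayWilliams2019 Thm 1.1 / Lemma 3.1 itself — MCSP[s] has O(N)-si

History (route lifecycle, newest last):
- 2026-08-15T16:19:37Z · rev 2: restated CircuitThesis (stmt-PneNP-0260), Assembly (stmt-PneNP-0261) — route-repair (glue + cone debt, unit rbadge-PneNP-Circuit-150c29df-g2): (1) CircuitThesis restated INLINE as ¬(NP ⊆ PPoly) — rfl-equal to the registered open st (planner-rbadge-PneNP-Circuit-150c29df-g2-0)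
- 2026-08-15T19:36:10Z · BROKEN — CircuitMagnificationFrontier (stmt-PneNP-0265, crux) refuted by Summit.PneNP.PneNP.Theorems.Circuit2CircuitMagnificationFrontier_refuted @ 4bec25c2c3a7 (refuter-rreview1-PneNP-Circuit-150c29df-0)
- 2026-08-15T20:11:14Z · rev 4: dropped CircuitMagnificationFrontier — repair: CircuitMagnificationFrontier (stmt-PneNP-0265, crux #5) refuted-MISSTATED by Summit.PneNP.PneNP.Theorems.Circuit2CircuitMagnificationFrontier_refuted @ (planner-rfix-PneNP-Circuit-150c29df-0)
- 2026-08-15T20:11:14Z · REPAIRED (drop CircuitMagnificationFrontier) — back to open: repair: CircuitMagnificationFrontier (stmt-PneNP-0265, crux #5) refuted-MISSTATED by Summit.PneNP.PneNP.Theorems.Circuit2CircuitMagnificationFrontier_refuted @ (planner-rfix-PneNP-Circuit-150c29df-0)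
- 2026-08-16T04:13:55Z · AUTO-CRUX (backfill): CircuitThesis — hypotheses of the deciding theorem that nothing in the route derives are cruxes (operator:999:1085951)
- 2026-08-23T13:43:45Z · DORMANT — reconciler: no traction for 6.1 d (last activity item-evidence-added at 2026-08-17T11:11:45Z); parked, not closed — `ledger route dormant route-PneNP-Circuit -- (operator:999:2595046)

sub-problem: PneNP · status: dormant · opened planner-PneNP-Survey-0 2026-08-13T06:08:16Z · rev 8 · ledger route-PneNP-Circuit
GENERATED by the gate from the ledger (D-0016/17). Provers cite these decls: `theorem foo : Summit.PneNP.PneNP.Theses.Circuit2.<Decl> := …` in Summits/PneNP/PneNP/Theorems/<Name>.lean.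
-/

namespace Summit.PneNP.PneNP.Theses.Circuit2

open scoped BigOperators Topology Manifold Classical MeasureTheory ProbabilityTheory Matrix InnerProductSpace ComplexConjugate ContinuousMap
open Filter Set Function TopologicalSpace MeasureTheory

attribute [summit_statement] _root_.PneNP

open Literature.PNP

-- earlier CircuitThesis (stmt-PneNP-0260, replaced 2026-08-15T16:19:37Z -> stmt-PneNP-10624): retired by None — Literature.Computability.Complexity.NPNotSubsetPPoly
/-- item stmt-PneNP-10624 · crux (kind.auto-crux: conjecture-grade) · rank 0 · open · by planner
why it might fail: NP ⊆ P/poly is consistent with all that is known: its only proved cost is PH = Σ₂ᵖ (karp_lipton, AB09 Thm 6.19); best explicit bound is 3.1n−o(n) (LiYang2022 Thm 1.1); natural proofs (RR97 Thm 4.1) and algebrization (AW08 Thm 5.6: NTIME^Ã(2ⁿ) ⊂ SIZE^A(n)) rule out every technique in hand.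
sources: KarpLipton1980, AroraBarakCC2009, Thm 6.19 (PDF p.142), p.343, LiYang2022, Thm 1.1, RazborovRudich1997, Thm 4.1, AaronsonWigderson2008, Thm 5.6, Literature.Barriers.PneNP.NaturalProofs
Route thesis X of PneNP/Circuit: some language in NP is decided by no polynomial-size family of
Boolean circuits [CookClay2006 §3; KarpLipton1980; AroraBarakCC2009 §6.4]. Stated INLINE — rfl-equal
to the registered open statement `Literature.Computability.Complexity.NPNotSubsetPPoly` (pnp.S02),
which is deliberately not referenced so that no open named fact sits in the route's dependency cone.
Decided by the route's `closes : CircuitThesis → PneNP` (rev 2: P_bool_eq_holds, NP_bool_eq_holds,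
P_subset_PPoly_holds). Crux #2 reaches it through `CircuitMcspGlue`. -/
@[route_item "route-PneNP-Circuit", crux]
def CircuitThesis : Prop :=
  ¬ (Literature.Computability.Complexity.Nondeterministic.NP ⊆ Literature.Computability.Complexity.PPoly)

/-- item stmt-PneNP-0262 · crux · rank 2 · open · by planner
why it might fail: Only conditional evidence: MCSP ∉ P/poly ⇐ 2^{n^ε}-hard OWF (RR97 Thm 4.1 + KC00); if no exp-hard OWF exists nothing known forces it, and it is not implied by X either: NP-hardness of MCSP under poly-time reductions already gives EXP ≠ ZPP (MurrayWilliams2017 Thm 1.6). Any proof must be non-natural.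
sources: RazborovRudich1997, Thm 4.1, KabanetsCai2000, §2, MurrayWilliams2017, Thm 1.3, 1.6, 4.1, ChenJinWilliams2020, p.3 ('widely believed … [KC00, ABK+02]'), AroraBarakCC2009, Thm 23.1 (PDF p.587), Literature.Barriers.PneNP.NaturalProofs (NaturalProofs.no_naturalProof_for)
The Minimum Circuit Size Problem has no polynomial-size circuits. Implies the thesis (MCSP ∈ NP).
MCSP ∈ P/poly would be a P/poly-natural property useful against P/poly, so by Razborov–Rudich
[RazborovRudich1997, Thm 4.1] no 2^{n^ε}-hard PRG in P/poly exists; conversely #2 follows from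
exponentially hard one-way functions [KabanetsCai2000]. Hardest and most informative crux. [sources:
RazborovRudich1997; KabanetsCai2000] [route PneNP/Circuit, rank 2] -/
@[route_item "route-PneNP-Circuit"]
def CircuitMcspNotPpoly : Prop :=
  Literature.Computability.MetaComplexity.MCSP ∉ Literature.Computability.Complexity.PPoly

/-- item stmt-PneNP-0263 · crux · rank 3 · open · by planner
why it might fail: SAT may have O(n)-size B₂-circuits for all we know: no superlinear bound for any NP function (3.1n−o(n), LiYang2022 Thm 1.1; AB09 p.343); gate elimination provably cannot go superlinear (GHKK2016 p.3); even NP ⊄ SIZE(O(n)) needs non-algebrizing ideas (AW08 Thm 5.6). n = |CNF code| (encoding caveat).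
sources: LiYang2022, Thm 1.1, AroraBarakCC2009, p.343 and Ex. 6.5/6.6 (Kannan), GolovnevHirschKnopKulikov2016, §1 p.3, Thm 3, Thm 5, AaronsonWigderson2008, Thm 5.6, Kannan1982, Thm 2, Literature.Barriers.PneNP.GateEliminationLimit (GateEliminationLimit.no_step_with_large_gain)
A quadratic circuit-size lower bound for SAT over the full binary basis B2 (O-form because SIZE (fun
n => n^k) is empty at length 0). Open; the best explicit lower bound for any function in NP (indeed
in P) is 3.1n - o(n) [Literature.Computability.Complexity.li_yang]. Necessary for the thesis.
[sources: AroraBarak2009; KarpLipton1980] [route PneNP/Circuit, rank 3] -/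
@[route_item "route-PneNP-Circuit"]
def CircuitSatQuadraticSize : Prop :=
  Literature.Computability.Complexity.SAT ∉ ⋃ c : ℕ, Literature.Computability.Complexity.SIZE (fun n => c * n ^ 2 + c)

/-- item stmt-PneNP-0264 · crux · rank 4 · open · by planner
why it might fail: NEXP ⊆ P/poly holds relative to an algebrizing oracle (AW08 Thm 5.6), so non-algebrizing ideas are needed; equivalent to NEXP = MA (IKW02); Williams' route needs CircuitSAT on general poly-size circuits in 2ⁿ·poly/n^{ω(1)} time (WilliamsSTOC2010 Thm 1.1), known only to ACC⁰∘THR. AB09 Frontier 1.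
sources: AaronsonWigderson2008, Thm 5.6 and p.27 (padding), ImpagliazzoKabanetsWigderson2002 (NEXP ⊆ P/poly ⇔ NEXP = MA), WilliamsSTOC2010, Thm 1.1 (p.3), p.4, Williams2014, Thm 1.1, AroraBarakCC2009, p.358 'Frontier 1', Literature.Computability.Complexity.williams_acc
Nondeterministic exponential time has no polynomial-size circuits. Implied by the thesis (NP ⊆
NEXP); the algorithms-to-lower-bounds method gives NEXP ⊄ ACC⁰ [Williams2010 =
Literature.Computability.Complexity.williams_acc] and would give #4 from a 2^n/n^{ω(1)} CircuitSAT
algorithm for general circuits. Refuting #4 kills the route. [sources: Williams2010; AroraBarak2009]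
[route PneNP/Circuit, rank 4] -/
@[route_item "route-PneNP-Circuit"]
def CircuitNexpNotPpoly : Prop :=
  ¬ Literature.Computability.Complexity.NEXP ⊆ Literature.Computability.Complexity.PPoly

/-- item stmt-PneNP-13658 · crux · rank 5 · open · by planner
why it might fail: Needs a superlinear B₂-size bound (beat N·s(log₂N)^c for all c) for an explicit NP language — record 3.1N−o(N) (LiYang2022 Thm 1.1); MCSP[s] HAS O(N)-size circuits with fan-in-Õ(s³) Σ₃SAT-oracle gates (MMW19 Lem 3.1), so localizable techniques fail (CHOPRS Thm 2); as strong as X via MMW19 Thm 1.4.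
sources: MckayMurrayWilliams2019, Thm 1.4 third bullet (p.3), §5 proof (p.16), Thm 1.1 / Lemma 3.1, arXiv191108297, §1.1–1.2, Thm 2, LiYang2022, Thm 1.1, GolovnevHirschKnopKulikov2016, §1, ChenJinWilliams2020, pp.3–4, Literature.Barriers.PneNP.Locality
[crux] REPAIRED CircuitMagnificationFrontier (stmt-PneNP-0265 was refuted-MISSTATED by
Summit.PneNP.PneNP.Theorems.Circuit2CircuitMagnificationFrontier_refuted: in the tree's STREAM model
update time is vacuous — per-N one-step TM2 machines — and a non-uniform update map streams MCSP[s]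
in space s^60+60 for EVERY s ≥ n, so the streaming form held for no s; the witness is a STREAM
membership and says nothing about SIZE). Repaired to the CIRCUIT form of hardness magnification,
McKay–Murray–Williams STOC 2019 Thm 1.4, third bullet (p.3; proof p.16 via Lemma 3.1 with ℓ = s³):
"Let s(n) ≥ n and A ∈ PH. If search-MCSP^A[s(n)] on inputs of length N = 2^n does not have circuits
of N·poly(s(n)) size and poly(s(n)) depth, then NP ⊄ P/poly." Item (A = ∅; DECISION instead of
search and NO depth restriction — both make the hypothesis stronger, so it still magnifies to the
thesis X; B₂ basis as everywhere in the tree, constant factors absorbed by ∀ c): there is a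
time-constructible size function s (hence s(n) ≥ n) with log s(n) = o(n) (the magnification regime
MCSP[2^{o(n)}], so the size bound N·s(log₂N)^c + c is N^{1+o(1)}) such that for every c the
parametrised Minimum Circuit Size Problem MCS -/
@[route_item "route-PneNP-Circuit"]
def CircuitMagnificationFrontierR : Prop :=
  ∃ s : ℕ → ℕ, Literature.Computability.Complexity.IsTimeConstructible s ∧ Asymptotics.IsLittleO Filter.atTop (fun n : ℕ => Real.log (s n)) (fun n : ℕ => (n : ℝ)) ∧ ∀ c : ℕ, Literature.Computability.MetaComplexity.MCSPSize s ∉ Literature.Computability.Complexity.SIZE (fun N : ℕ => N * s (Nat.log 2 N) ^ c + c)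

/-- item stmt-PneNP-1035 · support · rank 9 · closed · proved by Summit.PneNP.PneNP.Theorems.circuitMcspGlue_proof @ 0cd248dbd2fe (prover) · by planner
[support] glue, crux #2 → thesis X: MCSP ∈ NP
(`Literature.Computability.MetaComplexity.MCSP_mem_NP`, discharged as `MCSP_mem_NP_holds`,
MCSPProofs.lean) turns `CircuitMcspNotPpoly` (MCSP ∉ P/poly) into X = ¬(NP ⊆ P/poly) (written
inline; rfl-equal to `Literature.Computability.Complexity.NPNotSubsetPPoly` = `CircuitThesis`).
Two-line proof checked by the planner (Sketch2.lean rc 0, axioms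
propext/Classical.choice/Quot.sound): `intro h hsub; exact h (hsub
Literature.Computability.MetaComplexity.MCSP_mem_NP_holds)`; candidate file attached as evidence —
any idle prover may land it in Theorems/. Types the rationale's '⇒ X since MCSP ∈ NP'. [sources:
KabanetsCai2000 §1 (MCSP ∈ NP); RazborovRudich1997 Thm 4.1;
Literature.Computability.MetaComplexity.MCSP_mem_NP] [route PneNP/Circuit, rank 9, support] -/
@[route_item "route-PneNP-Circuit"]
def CircuitMcspGlue : Prop :=
  Literature.Computability.MetaComplexity.MCSP ∉ Literature.Computability.Complexity.PPoly → ¬ (Literature.Computability.Complexity.Nondeterministic.NP ⊆ Literature.Computability.Complexity.PPoly)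

/-- item stmt-PneNP-13940 · support · rank 9 · closed · proved by Summit.PneNP.PneNP.Theorems.circuitMagnificationGlue_proof @ b221eae22c77 (prover) · by planner
sources: MckayMurrayWilliams2019, Thm 1.4 third bullet (p.3), Lemma 3.1, §5 (p.16), Literature.Computability.MetaComplexity.MckayMurrayWilliams2019_thm14, Literature.Computability.MetaComplexity.not_NP_subset_PPoly_of_MCSP_lowerBound
[support] glue, crux #5R → thesis X: hardness magnification for MCSP[s] in its circuit form —
McKay–Murray–Williams 2019 Thm 1.4, third bullet (p.3; proof §5 p.16 via Lemma 3.1 with ℓ = s³),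
specialised to the route's crux: if some time-constructible s with log s(n) = o(n) has MCSP[s] =
`MCSPSize s` ∉ SIZE(N ↦ N·s(⌊log₂N⌋)^c + c) for every c (= `CircuitMagnificationFrontierR`,
stmt-PneNP-13658), then ¬(NP ⊆ P/poly) (= `CircuitThesis`, written inline). The signature is
FACT-FREE — `rfl`-equal to `CircuitMagnificationFrontierR → CircuitThesis`, spelled out over
MCSPSize/SIZE/NP/PPoly only, so the route's cone keeps 0 unproved deps. A published THEOREM, not a
conjecture: closable (a) by formalising MMW19 Lemma 3.1 + §5 over the tree's `MCSPSize`/`SIZE` (the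
O(N)-gate oracle circuit with Circuit-Min-Merge gates of fan-in Õ(s³), collapsed to poly(s)-size B₂
circuits under NP ⊆ P/poly; decision/depth-free/B₂ bookkeeping as in the CircuitMagnification.lean
module docstring) — the same work discharges the vendored unproved fact
`Literature.Computability.MetaComplexity.MckayMurrayWilliams2019_thm14`; or (b) in two lines once
that fact has a `_holds` witness: `rintro ⟨s, hs, -, hlb⟩; exact h -/
@[route_item "route-PneNP-Circuit"]
def CircuitMagnificationGlue : Prop :=
  (∃ s : ℕ → ℕ, Literature.Computability.Complexity.IsTimeConstructible s ∧ Asymptotics.IsLittleO Filter.atTop (fun n : ℕ => Real.log (s n)) (fun n : ℕ => (n : ℝ)) ∧ ∀ c : ℕ, Literature.Computability.MetaComplexity.MCSPSize s ∉ Literature.Computability.Complexity.SIZE (fun N : ℕ => N * s (Nat.log 2 N) ^ c + c)) → ¬ (Literature.Computability.Complexity.Nondeterministic.NP ⊆ Literature.Computability.Complexity.PPoly)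

-- earlier Assembly (stmt-PneNP-0261, replaced 2026-08-15T16:19:37Z -> stmt-PneNP-10625): retired by None — Literature.Computability.Complexity.P_subset_PPoly → Literature.Computability.Complexity.P_bool_eq → Literature.Computability.Complexity.NP_bool_eq → Literature.Computability.Complexity.P_subset_NP → Literature.Computability.Complexity.NPNotSubsetPPoly → PneNP
/-- item stmt-PneNP-10625 · assembly · rank 1 · closed · proved by Summit.PneNP.PneNP.Theorems.circuit_assembly_standalone (prover) · by planner
Assembly for route Circuit (rev 2): the thesis X = `CircuitThesis` (¬(NP ⊆ P/poly)) implies the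
summit statement `PneNP`. Proved inside the route file as the deciding theorem `closes` from the
discharged model bridges `Literature.Computability.Complexity.P_bool_eq_holds`, `NP_bool_eq_holds`
and `P ⊆ P/poly` = `P_subset_PPoly_holds` [AroraBarakCC2009 Thm 6.6, §6.4]; any prover closes this
item with `theorem … : Assembly := fun hX => Summit.PneNP.PneNP.Theses.Circuit2.closes hX`. Replaces
the rev-1 form whose hypotheses were those Literature facts themselves (unlisted items =
glue.extra-hypothesis). [sources: AroraBarakCC2009 §6.4, Thm 6.6; CookClay2006 §3] -/
@[route_item "route-PneNP-Circuit"]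
def Assembly : Prop :=
  CircuitThesis → PneNP

/-- `Assembly` holds: proved by `Summit.PneNP.PneNP.Theorems.circuit_assembly_standalone`. -/
theorem Assembly_holds : Assembly := _root_.Summit.PneNP.PneNP.Theorems.circuit_assembly_standalone

-- records of items no longer active in this route (dropped / restated):
-- earlier CircuitMagnificationFrontier (stmt-PneNP-0265, dropped 2026-08-15T20:11:14Z): refuted by Summit.PneNP.PneNP.Theorems.Circuit2CircuitMagnificationFrontier_refuted @ 4bec25c2c3a7 — ∃ s : ℕ → ℕ, Literature.Computability.Complexity.IsTimeConstructible s ∧ Asymptotics.IsLittleO Filter.atTop (fun n : ℕ => Real.log (s n)) (fun n : ℕ => (n : ℝ)) ∧ ∀ c : ℕ, Literature.Computability.MetaComplexity.M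

/-! D-0027 §2.1 — DECIDING THEOREM (planner-authored via `route open/edit --closes-file`; by planner-rfix-PneNP-Circuit-150c29df-0 2026-08-15T20:11:14Z):
its hypotheses are this route's items and its conclusion the sub-problem Statement (glue_lint), and it elaborates with this file. -/

@[closes "route-PneNP-Circuit"] theorem closes (hX : CircuitThesis) : _root_.PneNP := by
  -- X = ¬ (NP ⊆ P/poly). If P = NP failed to separate (¬ PneNP), every Cook-NP language is in Cook-P;
  -- transport along the model bridges (Cook's classes over {0,1} = the prelude classes) and use P ⊆ P/poly
  -- [AroraBarakCC2009, Thm. 6.6, discharged as `P_subset_PPoly_holds`] to get NP ⊆ P/poly, contradicting X.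
  by_contra hne
  apply hX
  intro L hL
  have hP : Literature.Computability.Complexity.PNPWave0.P Bool = Literature.Computability.Complexity.Classes.P :=
    Literature.Computability.Complexity.P_bool_eq_holds
  have hN : Literature.Computability.Complexity.PNPWave0.NP Bool = Literature.Computability.Complexity.Nondeterministic.NP :=
    Literature.Computability.Complexity.NP_bool_eq_holds
  have hLP : L ∈ Literature.Computability.Complexity.Classes.P := by
    by_contra hL'
    exact hne ⟨L, hN ▸ hL, hP ▸ hL'⟩
  exact Literature.Computability.Complexity.P_subset_PPoly_holds hLP

end Summit.PneNP.PneNP.Theses.Circuit2
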